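import Summits.QuantumFields.BalabanUV.T4Continuum.Support.NE7K1LinTorusResolventLine
import Summits.QuantumFields.BalabanUV.T4Continuum.Support.NE7K1LinStripClassLine
import Summits.QuantumFields.BalabanUV.T4Continuum.Support.NE7K1LinTorusLineEngine
import Summits.QuantumFields.BalabanUV.T4Continuum.Support.NE7K1LinStripClassSums

/-!
# NE7K1LinTorusResolventDict — row NE7 (node U5), candidate route HOM, path H1L, cell K1-lin(s): NEEDS-ESTIMATE #E1, R-E1 TRANCHE E
# (operator-level torus docking), STEP 3a — THE DICTIONARY between file 74's torus objects on an alias fibre (`mhatT`, `wMean`, the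
# fibre waves at a block offset) and b04's ∕ file 62–67's strip-engine objects (`lineSymb L n s ∘ shift`, `U`, `F`) at the real coarse
# momentum `θ(p)`: (α) `m̂_k = lineSymb L n s (θ(p) + 2πk)`, (β) `U_n(k; θ(p)) = |w_k(p)|²`, (γ) `F_n(τ, k; θ(p)) = χ_{q_k}(τ)·conj w_k(p)`

Lineage `b2b-balaban-t4-ne7-p2` (CRUX PROVER NE7 #2), generation 76; file 75.  With these three identities the regrouped fibre field of
files 72∕74 at a fine point `n·x⁰ + τ` reads `Φ^R_p(n x⁰ + τ) = χ_p(x⁰)·GS n (lineSymb L n s) a τ (θ(p))` (file 67's multiplier), which is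
what step 3b (successor) Fourier-inverts over `p` to file 68's `torusKernelS`.  [folklore] bookkeeping throughout:

* §1 integer-vector periodicity of the line's symbol: `lineSymb_update_int` (one coordinate, any integer multiple of `2πn`) and
  **`lineSymb_add_intVec`** (`lineSymb L n s (q + 2πn·m) = lineSymb L n s q`, `m ∈ ℤ^{d+1}`), from files 64∕65's one-step periodicity.
* §2 (α) **`mhatT_eq_lineSymb`**: for centred `p` (`2|p_μ| ≤ 2M_μ`), every residue `k` and every real `s`,
  `mhatT hn M s y₀ p k = lineSymb L n s (shift n k (ofRealVec (thetaOf (dbl M) p)))` — centre the fibre momentum `q_k` inside the fine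
  dual (`cShift`), move `torSymb` by `torSymb_sub_period` (file 61) and `lineSymb` by §1, and dock at the centred point by file 66's
  `lineSymb_eq_torSymb` (THEOREM I + THEOREM S — the ONLY place `s = 1` information enters, (k2)(k3) honoured).
* §3 (β) `U_eq_normSq_wMean` and (γ) **`F_eq_chiT_mul_conj_wMean`**: b04's `U`, `F` at `ofRealVec (thetaOf Pc p)` versus file 56–57's
  `wMean` and the fibre wave at the offset `kvec τ` (pure exponential-sum algebra: `wMean_eq_prod`, `chiT_fib_kvec_eq_prod`).
* §4 `RSf_mhatT_eq`, `ESf_mhatT_eq` and **`resFieldR_finePt`**: `Φ^R_p(n·x⁰ + τ) = χ_p(x⁰)·GS n (lineSymb L n s) a τ (ofRealVec θ(p))` —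
  file 74's resolvent field IS a coarse plane wave times file 67's multiplier over file 66's line symbol (centred `p`, every real `s`).

HONEST FRAMING: [folklore] identities between explicitly defined finite sums; nothing of Bałaban's asserted; no `sorry`.  Census only; NE7
NOT PRINTED ∕ NOT PROVED; spine 0∕9; FIXED FINITE T⁴, rung (B)+1; NOT infinite volume, NOT mass gap, NOT Clay.  HONEST DEPENDENCY: continuum
YM on T⁴ ⇐ BetaPertH ∧ nine spine estimates (0/9 proved); BetaPertH ⇐ (D1) ∧ (D4) ∧ CAP+tail; G-an2-4 gates asym, D1 and NE2/3/4.
-/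

noncomputable section

open Finset Matrix Complex

namespace Summit.QuantumFields.BalabanUV.T4Continuum.NE7K1LinTorusResolventDict

open Literature.MathematicalPhysics.QuantumFieldTheory.Balaban1983to89
open Literature.MathematicalPhysics.QuantumFieldTheory.Balaban1983to89.B4Reflection242
open Literature.MathematicalPhysics.QuantumFieldTheory.Balaban1983to89.B4Lower18
open Literature.MathematicalPhysics.QuantumFieldTheory.Balaban1983to89.B4Green244 (finePt)
open Literature.MathematicalPhysics.QuantumFieldTheory.Balaban1983to89.B4Strip (ofRealVec shift shift_zero U Ur U_ofReal)
open Literature.MathematicalPhysics.QuantumFieldTheory.Balaban1983to89.B4StripSums (w v ef F)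
open NE7K1LinFoldKernels NE7K1LinSchurFoldBox NE7K1LinTorusLineSymbol NE7K1LinTorusSymbolReal NE7K1LinTorusLineEngine
open NE7K1LinTorusFineWaves NE7K1LinTorusFineWavesFibre NE7K1LinTorusResolventLine
open NE7K1LinStripClass NE7K1LinStripClassCauchy NE7K1LinStripClassNN NE7K1LinStripClassKLConsts NE7K1LinStripClassKL NE7K1LinStripClassLine
open NE7K1LinStripClassSums NE7K1LinTorusResolventFibre

variable {d : ℕ}

/-! ### §1 Integer-vector periodicity of the line's symbol -/

section Periodic

variable {L n : ℕ} [NeZero L] [NeZero n]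

/-- one coordinate, natural multiples: `lineSymb (update q μ (q_μ + 2πn·m)) = lineSymb q`. [folklore] -/
theorem lineSymb_update_nat (s : ℝ) (q : Fin d → ℂ) (μ : Fin d) (m : ℕ) :
    lineSymb L n s (Function.update q μ (q μ + 2 * Real.pi * n * m)) = lineSymb L n s q := by
  unfold lineSymb
  rw [periodic_mul (symbS_DeltaXi_rK (d := d) n) q μ m, periodic_mul (symbS_scaledKL (d := d) L n) q μ m]

/-- one coordinate, integer multiples. [folklore] -/
theorem lineSymb_update_int (s : ℝ) (q : Fin d → ℂ) (μ : Fin d) (m : ℤ) :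
    lineSymb L n s (Function.update q μ (q μ + 2 * Real.pi * n * m)) = lineSymb L n s q := by
  cases m with
  | ofNat m =>
    have : ((Int.ofNat m : ℤ) : ℂ) = ((m : ℕ) : ℂ) := by simp
    rw [this, lineSymb_update_nat]
  | negSucc m =>
    -- shift down by `2πn(m+1)`, then up again
    set q' : Fin d → ℂ := Function.update q μ (q μ + 2 * Real.pi * n * (Int.negSucc m : ℤ)) with hq'
    have hup : Function.update q' μ (q' μ + 2 * Real.pi * n * ((m + 1 : ℕ) : ℂ)) = q := by
      funext ν
      by_cases hν : ν = μ
      · subst hν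
        simp only [hq', Function.update_self]
        have : ((Int.negSucc m : ℤ) : ℂ) = -((m + 1 : ℕ) : ℂ) := by simp [Int.negSucc_eq]
        rw [this]; ring
      · simp [hq', Function.update_of_ne hν]
    rw [← lineSymb_update_nat s q' μ (m + 1), hup]

/-- adding `c·e_μ` is a coordinate update. [folklore] -/
theorem add_single_eq_update (q : Fin d → ℂ) (μ : Fin d) (c : ℂ) :
    q + Pi.single μ c = Function.update q μ (q μ + c) := by
  funext ν
  by_cases hν : ν = μ
  · subst hν; simp
  · simp [hν]

/-- **INTEGER-VECTOR PERIODICITY**: `lineSymb L n s (q + 2πn·m) = lineSymb L n s q` for `m ∈ ℤ^{d}`. [folklore] -/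
theorem lineSymb_add_intVec (s : ℝ) (q : Fin d → ℂ) (m : Fin d → ℤ) :
    lineSymb L n s (q + fun μ => 2 * Real.pi * n * (m μ : ℂ)) = lineSymb L n s q := by
  classical
  have key : ∀ (S : Finset (Fin d)) (q : Fin d → ℂ),
      lineSymb L n s (q + ∑ μ ∈ S, Pi.single μ (2 * Real.pi * n * (m μ : ℂ))) = lineSymb L n s q := by
    intro S
    induction S using Finset.induction_on with
    | empty => intro q; simp
    | insert μ S hμ ih =>
      intro q
      rw [Finset.sum_insert hμ, ← add_assoc, ih, add_single_eq_update, lineSymb_update_int]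
  have e : (fun μ => 2 * Real.pi * n * (m μ : ℂ)) = ∑ μ ∈ Finset.univ, Pi.single μ (2 * Real.pi * n * (m μ : ℂ)) := by
    rw [Finset.univ_sum_single]
  rw [e]
  exact key Finset.univ q

end Periodic

/-! ### §2 (α): the torus eigenvalues on the fibre are the line symbol's shifted samples -/

section Alpha

variable {n L : ℕ} [NeZero n] [NeZero L] {M : Fin (d + 1) → ℕ}

/-- the centring shift of a fine dual index: `0` where `2q_μ ≤ P_μ`, `1` otherwise. [folklore] -/
def cShift (P : Fin (d + 1) → ℕ) (q : Fin (d + 1) → ℤ) : Fin (d + 1) → ℤ :=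
  fun μ => if 2 * q μ ≤ (P μ : ℤ) then 0 else 1

omit [NeZero n] in
/-- the fibre momenta of a centred coarse index, centred: `2|q_μ − P_μ·cShift_μ| ≤ P_μ`. [folklore] -/
theorem two_abs_centred_le (hn : 1 ≤ n) (hM : ∀ i, 1 ≤ M i) {p : Fin (d + 1) → ℤ} (hp : ∀ μ, 2 * |p μ| ≤ (dbl M μ : ℤ))
    (k : Fin (d + 1) → Fin n) (μ : Fin (d + 1)) :
    2 * |(fibMom (dbl M) p k - fun ν => (dbl (fun i => n * M i) ν : ℤ) * cShift (dbl fun i => n * M i) (fibMom (dbl M) p k) ν) μ| ≤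
      (dbl (fun i => n * M i) μ : ℤ) := by
  have hq : fibMom (dbl M) p k μ = p μ + (dbl M μ : ℤ) * (k μ : ℕ) := by simp [fibMom, kvec]
  have hM2 : (dbl M μ : ℤ) = 2 * M μ := by simp [dbl_apply]
  have hPμ : (dbl (fun i => n * M i) μ : ℤ) = 2 * (n * M μ) := by simp [dbl_apply]
  have hkn : (k μ : ℕ) + 1 ≤ n := (k μ).isLt
  have hk' : ((k μ : ℕ) : ℤ) ≤ (n : ℤ) - 1 := by omega
  have hpμ := hp μ
  rw [hM2] at hpμ
  have hp1 : p μ ≤ M μ := by have := le_abs_self (p μ); omega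
  have hp2 : -(M μ : ℤ) ≤ p μ := by have := neg_abs_le (p μ); omega
  have hMμ : (1 : ℤ) ≤ M μ := by exact_mod_cast hM μ
  have hk0 : (0 : ℤ) ≤ ((k μ : ℕ) : ℤ) := by positivity
  simp only [Pi.sub_apply, cShift, hq, hPμ]
  split_ifs with h
  · rw [hM2] at h ⊢
    have hx : |p μ + 2 * (M μ : ℤ) * ((k μ : ℕ) : ℤ)| ≤ n * M μ := abs_le.mpr ⟨by nlinarith, by nlinarith⟩
    rw [mul_zero, sub_zero]
    linarith
  · rw [hM2] at h ⊢
    have h' := lt_of_not_ge h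
    have hx : |p μ + 2 * (M μ : ℤ) * ((k μ : ℕ) : ℤ) - 2 * ((n : ℤ) * M μ) * 1| ≤ n * M μ :=
      abs_le.mpr ⟨by nlinarith, by nlinarith⟩
    linarith

omit [NeZero n] in
/-- the shifted real momentum IS `n·θ_fine(q_k)`: `θ(p)_μ + 2πk_μ = n·(2π q_{k,μ} ∕ 2nM_μ)`. [folklore] -/
theorem shift_thetaOf_eq (hn : 1 ≤ n) (hM : ∀ i, 1 ≤ M i) (p : Fin (d + 1) → ℤ) (k : Fin (d + 1) → Fin n) :
    shift n k (ofRealVec (thetaOf (dbl M) p)) =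
      ofRealVec (fun μ => (n : ℝ) * thetaOf (dbl fun i => n * M i) (fibMom (dbl M) p k) μ) := by
  funext μ
  have hM0 : (M μ : ℂ) ≠ 0 := by exact_mod_cast (show M μ ≠ 0 by have := hM μ; omega)
  have hn0 : (n : ℂ) ≠ 0 := by exact_mod_cast (show n ≠ 0 by omega)
  have hq : (fibMom (dbl M) p k μ : ℝ) = p μ + (dbl M μ : ℝ) * (k μ : ℕ) := by
    have : fibMom (dbl M) p k μ = p μ + (dbl M μ : ℤ) * (k μ : ℕ) := by simp [fibMom, kvec]
    exact_mod_cast congrArg (fun z : ℤ => (z : ℝ)) this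
  simp only [shift, ofRealVec, thetaOf, dbl_apply, hq]
  push_cast
  field_simp

omit [NeZero n] in
/-- the un-centring on the line side: `n·θ_fine(q) = n·θ_fine(c) + 2πn·cShift` coordinatewise. [folklore] -/
theorem ofRealVec_theta_uncentre (hn : 1 ≤ n) (hM : ∀ i, 1 ≤ M i) (q : Fin (d + 1) → ℤ) (m : Fin (d + 1) → ℤ) :
    ofRealVec (fun μ => (n : ℝ) * thetaOf (dbl fun i => n * M i) q μ) =
      ofRealVec (fun μ => (n : ℝ) * thetaOf (dbl fun i => n * M i) (q - fun ν => (dbl (fun i => n * M i) ν : ℤ) * m ν) μ) +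
        fun μ => 2 * Real.pi * n * (m μ : ℂ) := by
  funext μ
  have hP0 : ((dbl (fun i => n * M i) μ : ℕ) : ℂ) ≠ 0 := by
    have h1 : n * M μ ≠ 0 := Nat.mul_ne_zero (by omega) (by have := hM μ; omega)
    have : dbl (fun i => n * M i) μ ≠ 0 := by simp only [dbl_apply]; omega
    exact_mod_cast this
  simp only [ofRealVec, thetaOf, Pi.add_apply, Pi.sub_apply]
  push_cast
  field_simp
  ring

/-- **(α) THE TORUS EIGENVALUES ARE THE LINE SYMBOL'S SHIFTED SAMPLES**: for centred `p` (`2|p_μ| ≤ 2M_μ`), every residue `k` and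
every real `s`, `mhatT hn M s y₀ p k = lineSymb L n s (shift n k (ofRealVec (thetaOf (dbl M) p)))`. [folklore] -/
theorem mhatT_eq_lineSymb (hn : 1 ≤ n) (hM : ∀ i, 1 ≤ M i) (s : ℝ) (y₀ : ↥(boxDom (dbl fun i => n * M i)))
    {p : Fin (d + 1) → ℤ} (hp : ∀ μ, 2 * |p μ| ≤ (dbl M μ : ℤ)) (k : Fin (d + 1) → Fin n) :
    mhatT (L := L) hn M s y₀ p k = lineSymb L n s (shift n k (ofRealVec (thetaOf (dbl M) p))) := by
  set q := fibMom (dbl M) p k with hqdef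
  set m := cShift (dbl fun i => n * M i) q with hmdef
  set c := q - fun ν => (dbl (fun i => n * M i) ν : ℤ) * m ν with hcdef
  -- torus side: `torSymb q = torSymb c`
  have h1 : mhatT (L := L) hn M s y₀ p k = torSymb (L := L) hn M s y₀ c := by
    unfold mhatT; rw [← hqdef, hcdef, torSymb_sub_period (L := L) hn hM s y₀ q m]
  -- line side: move to `n·θ(q)`, un-centre to `n·θ(c) + 2πn·m`, drop the period
  rw [h1, shift_thetaOf_eq hn hM p k, ← hqdef, ofRealVec_theta_uncentre hn hM q m, ← hcdef, lineSymb_add_intVec]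
  exact (lineSymb_eq_torSymb (L := L) hn hM y₀ (fun μ => two_abs_centred_le hn hM hp k μ) s).symm

end Alpha

/-! ### §3 (β)(γ): b04's `U` and `F` at the real coarse momentum versus the block mean and the fibre wave -/

section BetaGamma

variable {n : ℕ} [NeZero n] {Pc : Fin (d + 1) → ℕ}

/-- (β) `U_n(k; θ(p)) = |w_k(p)|²` (as a complex number). [folklore] -/
theorem U_eq_normSq_wMean (hPc : ∀ i, 1 ≤ Pc i) {p : Fin (d + 1) → ℤ} (hp : ∀ μ, |p μ| < Pc μ) (k : Fin (d + 1) → Fin n) :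
    U n k (ofRealVec (thetaOf Pc p)) = ((Complex.normSq (wMean n Pc p k) : ℝ) : ℂ) := by
  rw [U_ofReal, normSq_wMean hPc hp]

/-- (β′) `U_n(k; θ(p)) = w_k · conj w_k`. [folklore] -/
theorem U_eq_wMean_mul_conj (hPc : ∀ i, 1 ≤ Pc i) {p : Fin (d + 1) → ℤ} (hp : ∀ μ, |p μ| < Pc μ) (k : Fin (d + 1) → Fin n) :
    U n k (ofRealVec (thetaOf Pc p)) = wMean n Pc p k * starRingEnd ℂ (wMean n Pc p k) := by
  rw [U_ofReal, wMean_mul_conj hPc hp]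

omit [NeZero n] in
/-- one coordinate of (γ), the averaging factor: `conj (n⁻¹ Σ_t e^{it(θ+2πk)∕n}) = v_n(k; θ)`. [folklore] -/
theorem conj_meanExp_eq_v (θ : ℝ) (k : ℕ) :
    starRingEnd ℂ (((n : ℂ))⁻¹ * ∑ t : Fin n, Complex.exp ((t : ℕ) * ((((θ + 2 * Real.pi * (k : ℝ)) / n : ℝ)) : ℂ) * Complex.I)) =
      v n k (θ : ℂ) := by
  unfold v w
  rw [Finset.sum_range, map_mul, map_inv₀, Complex.conj_natCast, map_sum]
  congr 1
  refine Finset.sum_congr rfl (fun t _ => ?_)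
  rw [← Complex.exp_conj, ← Complex.exp_nat_mul]
  congr 1
  simp only [map_mul, Complex.conj_natCast, Complex.conj_ofReal, Complex.conj_I]
  push_cast
  ring

omit [NeZero n] in
/-- one coordinate of (γ), the phase: `e^{iτ(θ+2πk)∕n} = ef n k τ θ`. [folklore] -/
theorem exp_offset_eq_ef (k τ : ℕ) (θ : ℝ) :
    Complex.exp ((τ : ℕ) * ((((θ + 2 * Real.pi * (k : ℝ)) / n : ℝ)) : ℂ) * Complex.I) = ef n k τ (θ : ℂ) := by
  unfold ef
  congr 1
  push_cast
  ring

/-- **(γ) b04's `F` IS THE FIBRE WAVE AT THE OFFSET TIMES THE CONJUGATE BLOCK MEAN**: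
`F n τ k (ofRealVec θ(p)) = χ_{q_k}(kvec τ) · conj w_k(p)`. [folklore] -/
theorem F_eq_chiT_mul_conj_wMean (hPc : ∀ i, 1 ≤ Pc i) (p : Fin (d + 1) → ℤ) (τ k : Fin (d + 1) → Fin n) :
    F n τ k (ofRealVec (thetaOf Pc p)) =
      chiT (fun i => n * Pc i) (fibMom Pc p k) (kvec τ) * starRingEnd ℂ (wMean n Pc p k) := by
  rw [chiT_fib_kvec_eq_prod hPc p k τ, wMean_eq_prod hPc p k, map_prod, ← Finset.prod_mul_distrib]
  unfold F
  refine Finset.prod_congr rfl (fun ν _ => ?_)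
  rw [ofRealVec, conj_meanExp_eq_v, exp_offset_eq_ef]

end BetaGamma

/-! ### §4 The fibre field at a fine point IS a coarse plane wave times the strip-engine multiplier `GS` -/

section Multiplier

variable {n L : ℕ} [NeZero n] [NeZero L] {M : Fin (d + 1) → ℕ}

/-- the regrouped ratio over the torus eigenvalues IS file 67's `RS` of the line symbol at `θ(p)` (centred `p`). [folklore] -/
theorem RSf_mhatT_eq (hn : 1 ≤ n) (hM : ∀ i, 1 ≤ M i) (s : ℝ) (y₀ : ↥(boxDom (dbl fun i => n * M i)))
    {p : Fin (d + 1) → ℤ} (hp : ∀ μ, 2 * |p μ| ≤ (dbl M μ : ℤ)) (k : Fin (d + 1) → Fin n) :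
    RSf n (mhatT (L := L) hn M s y₀ p) k = RS n (lineSymb L n s) k (ofRealVec (thetaOf (dbl M) p)) := by
  unfold RSf RS
  rw [mhatT_eq_lineSymb (L := L) hn hM s y₀ hp, mhatT_eq_lineSymb (L := L) hn hM s y₀ hp, shift_zero]

/-- the regrouped denominator over the torus eigenvalues IS file 62's `ES` of the line symbol at `θ(p)` (centred `p`). [folklore] -/
theorem ESf_mhatT_eq (hn : 1 ≤ n) (hM : ∀ i, 1 ≤ M i) (s : ℝ) (y₀ : ↥(boxDom (dbl fun i => n * M i)))
    {p : Fin (d + 1) → ℤ} (hp : ∀ μ, 2 * |p μ| ≤ (dbl M μ : ℤ)) (a : ℝ) :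
    ESf n (dbl M) (mhatT (L := L) hn M s y₀ p) a p = ES n (lineSymb L n s) a (ofRealVec (thetaOf (dbl M) p)) := by
  unfold ESf ES
  simp_rw [U_ofReal, mhatT_eq_lineSymb (L := L) hn hM s y₀ hp, shift_zero]

/-- **THE FIBRE FIELD AT A FINE POINT**: for centred `p`, `Φ^R_p(n·x⁰ + τ) = χ_p(x⁰) · GS n (lineSymb L n s) a τ (θ(p))` — file 74's
explicit resolvent field IS a coarse plane wave times the strip engine's multiplier (file 67's `GS` over the class-S symbol of the line,
file 66). [folklore] -/
theorem resFieldR_finePt (hn : 1 ≤ n) (hM : ∀ i, 1 ≤ M i) (s : ℝ) (y₀ : ↥(boxDom (dbl fun i => n * M i)))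
    {p : Fin (d + 1) → ℤ} (hp : ∀ μ, 2 * |p μ| ≤ (dbl M μ : ℤ)) (a : ℝ) (x₀ : Fin (d + 1) → ℤ) (τ : Fin (d + 1) → Fin n) :
    resFieldR n (dbl fun i => n * M i) (dbl M) (mhatT (L := L) hn M s y₀ p) a p (finePt n x₀ τ) =
      chiT (dbl M) p x₀ * GS n (lineSymb L n s) a τ (ofRealVec (thetaOf (dbl M) p)) := by
  have hPc : ∀ i, 1 ≤ dbl M i := dbl_pos hM
  unfold resFieldR GS termS
  rw [Finset.mul_sum]
  refine Finset.sum_congr rfl (fun k _ => ?_)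
  rw [dbl_nmul n M, chiT_fib_finePt rfl hPc p k x₀ τ, F_eq_chiT_mul_conj_wMean hPc p τ k,
    RSf_mhatT_eq (L := L) hn hM s y₀ hp k]
  have hE : ESf n (dbl M) (mhatT (L := L) hn M s y₀ p) a p = ES n (lineSymb L n s) a (ofRealVec (thetaOf (dbl M) p)) :=
    ESf_mhatT_eq (L := L) hn hM s y₀ hp a
  -- `ESf` is stated over `dbl M`; after `dbl_nmul` the field's period argument changed but `ESf`'s did not
  rw [hE]
  ring

end Multiplier

end Summit.QuantumFields.BalabanUV.T4Continuum.NE7K1LinTorusResolventDict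

end
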